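import Summits.Langlands.Langlands.Theses.ExteriorSquareAscent
import Literature.NumberTheory.Automorphic.BockleHuiIrreducibleGL3ReductionProofs
import Literature.NumberTheory.GaloisRepresentations.PowLocallyAlgebraicProofs
import Literature.NumberTheory.Automorphic.IdeleNormDetGL
import Literature.NumberTheory.Automorphic.CuspidalDescentDetCubicRepData

/-!
# Stub `stub_lineHecke` of line `Sketch` for crux stmt-Langlands-18054
(`Summit.Langlands.Langlands.Theses.ExteriorSquareAscent.ReducibleInducesSquare`)

The Galois → automorphic passage of the `(3,1)` case (Böckle–Hui 2025, §3.2.1 for `n = 4`;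
Shavali 2026, Prop. 4.1).  Let `π` be cuspidal on `GL₄(𝔸_K)`, `ρ : Γ_K → GL₄(ℚ̄_ℓ)` semisimple,
Satake–Frobenius compatible with `(π, ι)` at almost all places and `E`-rational for some number
field `E`, and let `W` be a `Γ_K`-stable LINE of the underlying representation.  Then there is a
Hecke character `μ` of `K` with `μ(ϖ_v) ∈ t_{π,v}` for almost all `v`:

* the line carries a continuous character `τ : Γ_K → GL₁(ℚ̄_ℓ)` with `ρ(g) x = det τ(g) • x`
  (`exists_stableLine_of_finrank_eq_one`, `FramedRep.exists_rankOne_of_stableLine`);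
* `τ` weakly divides the `E`-rational semisimple `ρ`, so Böckle–Hui's Theorem 1.1 (PROVED in the
  tree, `exists_heckeCharacter_of_weaklyDivides_holds`, through its stable-line corollary
  `exists_heckeCharacter_of_stableLine`) produces an algebraic Hecke character `χ` with
  `τ(Frob_v) = ι⁻¹(χ(ϖ_v))⁻¹` at almost all `v`;
* at a good place, the eigenvalue of `ρ(Frob_v)` on the line is a root of
  `arithFrobPolyOfSatake ι q_v 4 α = ∏_{a ∈ α} (X - ι⁻¹(((√q_v)³ a)⁻¹))`, so
  `χ(ϖ_v) = (√q_v)³ a` for some `a ∈ α` (`exists_mem_satake_valueAtUniformizer_eq_of_frob`, the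
  per-place core of the tree's `exists_mem_satake_valueAtUniformizer_eq_of_stableLine`, re-proved
  for the almost-everywhere form of the compatibility hypothesis);
* with `λ = ‖·‖^{3/2}` (`exists_heckeCharacter_ideleNorm_cpow`, `λ(ϖ_v) = (q_v^{3/2})⁻¹`), the
  Hecke character `μ = χ λ` has `μ(ϖ_v) = a ∈ α`; uniqueness of Satake parameters
  (`AutomorphicRepData.hasSatakeParamAt_unique_holds`) turns `∃ α` into `∀ α`.
-/

set_option linter.dupNamespace false -- `Summit.Langlands.Langlands` is the mandated namespace (lakefile weak.linter.dupNamespace)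

noncomputable section

namespace Summit.Langlands.Langlands.Cruxes.ReducibleInducesSquare.Sketch

open Literature.NumberTheory.GaloisRepresentations Literature.NumberTheory.Automorphic
open NumberField IsDedekindDomain Field Filter Polynomial
open scoped Classical Matrix MatrixGroups NumberField

/-! ### Per-place core: the Frobenius value of the character on a stable line -/

section OnePlace

variable {K : Type} [Field K] [NumberField K] {ℓ : ℕ} [Fact ℓ.Prime] {n : ℕ}

/-- **The eigenvalue on a stable line at a good place.**  If `r(g) x = det(τ g) • x` (`x ≠ 0`) and
`det(X - r(σ)) = arithFrobPolyOfSatake ι q_v n α` for the arithmetic Frobenii `σ` at `v`, then for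
every such `σ`, `det τ(σ) = ι⁻¹(((√q_v)^{n-1} a)⁻¹)` for some `a ∈ α`: an eigenvalue of `r(σ)` is a
root of its characteristic polynomial (`Matrix.eval_charpoly`, `Matrix.exists_mulVec_eq_zero_iff`),
and the roots are listed by `roots_arithFrobPolyOfSatake`.  Per-place form of the tree's
`stableLine_isUnramifiedAt_and_det_eq`. [cite: BockleHui2025, §3.2.1] -/
theorem exists_det_eq_of_stableLine_of_frob (ι : PadicAlgCl ℓ ≃+* ℂ)
    (r : FramedGaloisRep K (PadicAlgCl ℓ) n)
    {τ : FramedGaloisRep K (PadicAlgCl ℓ) 1} {x : Fin n → PadicAlgCl ℓ} (hx0 : x ≠ 0)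
    (hx : ∀ g : absoluteGaloisGroup K,
      r.toGaloisRep g x = ((Matrix.GeneralLinearGroup.det (τ g) : (PadicAlgCl ℓ)ˣ) : PadicAlgCl ℓ) • x)
    {v : HeightOneSpectrum (𝓞 K)} {α : Multiset ℂ}
    (hP : r.HasFrobCharpolyAt v (arithFrobPolyOfSatake ι v.residueCard n α)) :
    ∀ 𝔓 ∈ v.primesAbove, ∀ σ : absoluteGaloisGroup K, IsArithFrobAt (𝓞 K) σ 𝔓 →
      ∃ a ∈ α, ((Matrix.GeneralLinearGroup.det (τ σ) : (PadicAlgCl ℓ)ˣ) : PadicAlgCl ℓ) =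
        ι.symm ((((Real.sqrt (v.residueCard : ℝ) : ℝ) : ℂ) ^ (n - 1) * a)⁻¹) := by
  intro 𝔓 h𝔓 σ hσ
  -- matrix form of the eigenvector equation
  have hmul : ((r σ : GL (Fin n) (PadicAlgCl ℓ)) : Matrix (Fin n) (Fin n) (PadicAlgCl ℓ)) *ᵥ x =
      ((Matrix.GeneralLinearGroup.det (τ σ) : (PadicAlgCl ℓ)ˣ) : PadicAlgCl ℓ) • x := by
    simpa using hx σ
  set d : PadicAlgCl ℓ := ((Matrix.GeneralLinearGroup.det (τ σ) : (PadicAlgCl ℓ)ˣ) : PadicAlgCl ℓ)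
  have hchar : FramedRep.charpoly r σ = arithFrobPolyOfSatake ι v.residueCard n α := hP 𝔓 h𝔓 σ hσ
  have hroot : (FramedRep.charpoly r σ).IsRoot d := by
    rw [IsRoot.def, FramedRep.charpoly, Matrix.eval_charpoly, ← Matrix.exists_mulVec_eq_zero_iff]
    refine ⟨x, hx0, ?_⟩
    rw [Matrix.sub_mulVec, hmul]
    ext j
    simp [Matrix.scalar_apply, d]
  have hne : arithFrobPolyOfSatake ι v.residueCard n α ≠ 0 := by
    refine (Polynomial.monic_multiset_prod_of_monic _ _ fun a _ => ?_).ne_zero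
    exact Polynomial.monic_X_sub_C _
  have hmem : d ∈ (arithFrobPolyOfSatake ι v.residueCard n α).roots := by
    rw [Polynomial.mem_roots hne, ← hchar]
    exact hroot
  rw [roots_arithFrobPolyOfSatake, Multiset.mem_map] at hmem
  obtain ⟨a, ha, hda⟩ := hmem
  exact ⟨a, ha, hda.symm⟩

/-- **The Hecke character of the stable line, read at Satake level, at one good place.**  If
moreover `τ(Frob_v) = ι⁻¹(χ(ϖ_v))⁻¹` (`τ.HasFrobCharpolyAt v (X - C (ι⁻¹(χ(ϖ_v))⁻¹))`, the
conclusion of Böckle–Hui's Theorem 1.1), then `χ(ϖ_v) = (√q_v)^{n-1} a` for some `a ∈ α`: both are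
`ι(det τ(Frob_v))⁻¹` (a Frobenius at `v` exists, `HeightOneSpectrum.primesAbove_nonempty`,
`HeightOneSpectrum.exists_isArithFrobAt_of_mem_primesAbove_holds`).  Per-place form of the tree's
`exists_mem_satake_valueAtUniformizer_eq_of_stableLine`. [cite: BockleHui2025, §3.2.1] -/
theorem exists_mem_satake_valueAtUniformizer_eq_of_frob (ι : PadicAlgCl ℓ ≃+* ℂ)
    (r : FramedGaloisRep K (PadicAlgCl ℓ) n)
    {τ : FramedGaloisRep K (PadicAlgCl ℓ) 1} {x : Fin n → PadicAlgCl ℓ} (hx0 : x ≠ 0)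
    (hx : ∀ g : absoluteGaloisGroup K,
      r.toGaloisRep g x = ((Matrix.GeneralLinearGroup.det (τ g) : (PadicAlgCl ℓ)ˣ) : PadicAlgCl ℓ) • x)
    {v : HeightOneSpectrum (𝓞 K)} {α : Multiset ℂ}
    (hP : r.HasFrobCharpolyAt v (arithFrobPolyOfSatake ι v.residueCard n α))
    {χ : HeckeCharacter K}
    (hτ : τ.HasFrobCharpolyAt v (X - C (ι.symm (χ.valueAtUniformizer v)⁻¹))) :
    ∃ a ∈ α, χ.valueAtUniformizer v = ((Real.sqrt (v.residueCard : ℝ) : ℝ) : ℂ) ^ (n - 1) * a := by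
  obtain ⟨𝔓, h𝔓⟩ := HeightOneSpectrum.primesAbove_nonempty v
  obtain ⟨σ, hσ⟩ := HeightOneSpectrum.exists_isArithFrobAt_of_mem_primesAbove_holds h𝔓
  obtain ⟨a, ha, hdet⟩ := exists_det_eq_of_stableLine_of_frob ι r hx0 hx hP 𝔓 h𝔓 σ hσ
  refine ⟨a, ha, ?_⟩
  have hch := hτ 𝔓 h𝔓 σ hσ
  rw [FramedGaloisRep.charpoly_eq_X_sub_C_det, sub_right_inj, Polynomial.C_inj, hdet] at hch
  have h2 := ι.symm.injective hch
  rw [inv_inj] at h2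
  exact h2.symm

end OnePlace

/-! ### Bookkeeping: `(√q)³ = q^{3/2}` and products of Hecke characters at a uniformizer -/

/-- `(√q)³ = q^{3/2}` in `ℂ` (`Real.sqrt_eq_rpow`, `Complex.ofReal_cpow`, `Complex.cpow_nat_mul`).
[folklore] -/
theorem ofReal_sqrt_pow_three (q : ℕ) :
    ((Real.sqrt (q : ℝ) : ℝ) : ℂ) ^ 3 = (q : ℂ) ^ ((3 : ℂ) / 2) := by
  rw [Real.sqrt_eq_rpow, Complex.ofReal_cpow (Nat.cast_nonneg q), ← Complex.cpow_nat_mul,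
    Complex.ofReal_natCast]
  congr 1
  push_cast
  ring

/-- `(χ ψ)(ϖ_v) = χ(ϖ_v) ψ(ϖ_v)`. [folklore] -/
theorem valueAtUniformizer_mul_eq {K : Type} [Field K] [NumberField K] (χ ψ : HeckeCharacter K)
    (v : HeightOneSpectrum (𝓞 K)) :
    (χ * ψ).valueAtUniformizer v = χ.valueAtUniformizer v * ψ.valueAtUniformizer v := by
  simp only [HeckeCharacter.valueAtUniformizer, HeckeCharacter.localComponent_apply,
    HeckeCharacter.mul_apply, Units.val_mul]

/-! ### The stub -/

/-- **STUB A — the character of a stable line is a Hecke character among the Satake eigenvalues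
(any `K`).**  For `π` cuspidal on `GL₄(𝔸_K)`, `ρ : Γ_K → GL₄(ℚ̄_ℓ)` semisimple, a.e.
Satake–Frobenius compatible with `(π, ι)` and `E`-rational for some number field `E`, and a
`Γ_K`-stable LINE `W`: there is a Hecke character `μ` of `K` with `μ(ϖ_v) ∈ t_{π,v}` for almost all
`v`.  Route: stable line ⇒ character `τ` on it (`exists_stableLine_of_finrank_eq_one`,
`FramedRep.exists_rankOne_of_stableLine`); `τ` weakly divides `ρ`; Böckle–Hui Thm 1.1
(`exists_heckeCharacter_of_weaklyDivides_holds`, via `exists_heckeCharacter_of_stableLine`) gives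
an algebraic `χ` with `τ(Frob_v) = ι⁻¹(χ(ϖ_v))⁻¹`; compatibility reads
`τ(Frob_v) = ι⁻¹(((√q_v)³ a)⁻¹)`, `a ∈ t_{π,v}` (`exists_mem_satake_valueAtUniformizer_eq_of_frob`),
so `μ := χ · ‖·‖^{3/2}` (`exists_heckeCharacter_ideleNorm_cpow`,
`HeckeCharacter.valueAtUniformizer_of_cpow`) works; `∃ α ↦ ∀ α` by
`AutomorphicRepData.hasSatakeParamAt_unique_holds`.
[cite: BockleHui2025, Thm. 1.1 and §3.2.1] [cite: Shavali2026, Prop. 4.1] -/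
theorem stub_lineHecke :
    ∀ (K : Type) [Field K] [NumberField K]
      (hcpt : Literature.NumberTheory.Automorphic.isCompact_glFiniteIntegralLevel 4 K)
      (π : Literature.NumberTheory.Automorphic.CuspidalAutomorphicRepData 4 K hcpt)
      (ℓ : ℕ) [Fact ℓ.Prime] (ι : PadicAlgCl ℓ ≃+* ℂ)
      (ρ : Literature.NumberTheory.GaloisRepresentations.FramedGaloisRep K (PadicAlgCl ℓ) 4),
      ρ.toGaloisRep.IsSemisimple →
      (∀ᶠ v : IsDedekindDomain.HeightOneSpectrum (NumberField.RingOfIntegers K) in Filter.cofinite,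
        ∃ α : Multiset ℂ, π.1.HasSatakeParamAt v α ∧ ρ.IsUnramifiedAt v ∧
          ρ.HasFrobCharpolyAt v
            (Literature.NumberTheory.Automorphic.arithFrobPolyOfSatake ι v.residueCard 4 α)) →
      (∃ (E : Type) (_ : Field E) (_ : NumberField E) (e : E →+* PadicAlgCl ℓ), ρ.IsRationalOver e) →
      ∀ W : Subrepresentation ρ.toGaloisRep.toRepresentation,
        Module.finrank (PadicAlgCl ℓ) W.toSubmodule = 1 →
        ∃ μ : Literature.NumberTheory.GaloisRepresentations.HeckeCharacter K,
          ∀ᶠ v : IsDedekindDomain.HeightOneSpectrum (NumberField.RingOfIntegers K) in Filter.cofinite,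
            ∀ α : Multiset ℂ, π.1.HasSatakeParamAt v α → μ.valueAtUniformizer v ∈ α := by
  intro K _ _ hcpt π ℓ _ ι ρ hss hcomp hrat W hW
  -- Step 1: the stable line and its continuous character `τ`
  obtain ⟨x, hx0, hx⟩ := exists_stableLine_of_finrank_eq_one ρ.toGaloisRep.toRepresentation hW
  obtain ⟨τ, hτ⟩ := FramedRep.exists_rankOne_of_stableLine ρ hx0 hx
  have hτ' : ∀ g : absoluteGaloisGroup K,
      ρ.toGaloisRep g x = ((Matrix.GeneralLinearGroup.det (τ g) : (PadicAlgCl ℓ)ˣ) : PadicAlgCl ℓ) • x :=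
    fun g => by simpa using hτ g
  -- Step 2: `E`-rationality and Böckle–Hui's Theorem 1.1: `τ` comes from an algebraic Hecke character
  obtain ⟨E, _, _, e, hre⟩ := hrat
  obtain ⟨χ, -, hχ⟩ := exists_heckeCharacter_of_stableLine exists_heckeCharacter_of_weaklyDivides_holds
    e hss hre τ ⟨x, hx0, hτ'⟩ ι
  -- Step 3: the twist by `‖·‖^{3/2}`
  obtain ⟨lam, hlam⟩ := exists_heckeCharacter_ideleNorm_cpow K ((3 : ℂ) / 2)
  refine ⟨χ * lam, ?_⟩
  filter_upwards [hcomp, hχ] with v hv hχv α hα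
  obtain ⟨α', hα', -, hP⟩ := hv
  have hαα : α' = α := π.1.hasSatakeParamAt_unique_holds hα' hα
  subst hαα
  obtain ⟨a, ha, he⟩ := exists_mem_satake_valueAtUniformizer_eq_of_frob ι ρ hx0 hτ' hP hχv.2.2
  have hq0 : ((Real.sqrt (v.residueCard : ℝ) : ℝ) : ℂ) ^ 3 ≠ 0 := by
    refine pow_ne_zero _ ?_
    rw [Complex.ofReal_ne_zero]
    exact Real.sqrt_ne_zero'.2 (by exact_mod_cast lt_trans zero_lt_one v.one_lt_residueCard)
  rw [valueAtUniformizer_mul_eq, HeckeCharacter.valueAtUniformizer_of_cpow hlam v, he,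
    show (4 - 1 : ℕ) = 3 from rfl, ← ofReal_sqrt_pow_three, mul_comm, ← mul_assoc,
    inv_mul_cancel₀ hq0, one_mul]
  exact ha

end Summit.Langlands.Langlands.Cruxes.ReducibleInducesSquare.Sketch

end
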